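import Summits.QuantumFields.YangMills.Theorems.BalabanUVNodesN15TwoGridMeanValue
import HarnessLib

/-!
# Route «BalabanUVNodes», node N15 = NE2, -a lane, part 58: ENTRY 1 OF [B9] (3.42) FOR BAŁABAN's FULL PAIR `(G′, G)` AT `U ≡ 1` — THE INTERPOLATION CORE:
# `𝔇(∇_νG) = ∇′_νG′P − P∇_νG` SPLIT, MEAN VALUE ALONG `ν`, AND THE ONE-TORUS ESTIMATE WITH EXPLICIT CONSTANTS (free interpolation length `r`)

Cell `pub-ymgap`, seat `pub-ymgap-dag-n15-a` (KNIT-BY-NAME, g13); `--kind proof --supports stmt-QuantumFields-20507 --as helper`.  Over part 57 (`…TwoGridMeanValue`: `symbOp_sD_meanValue`,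
`symbOp_sT_pow_mul_sub_one_comp_pull`), part 44 §33 (`hasMaj_shiftPull_sub`), part 43 (`hasMaj_pull_comp₂`), part 40 (transfer calculus), part 34 (`symbOp_sD_sSm_comp_pull`).
THE ARGUMENT (g12 located entry 1 as needing (1.112) with ε-Hölder SOURCE norms — a currency the tree lacks; this route avoids it).  With `D′ = ρ′(n′(s_ν−1))`, `D = ρ(n(s_ν−1))`,
`P̂₂ = ρ′(Π_μa_μ²)∘P`, `X = ρ′(a_νΠ_{μ≠ν}a_μ²)` (so `D′∘P̂₂ = X∘P∘D` exactly, §73 `sD_sSm_pull_eq`):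
  `T1 := idef P P (D′∘G′) (D∘G) = D′∘F₂ + (X∘P − P)∘D∘G`, `F₂ := idef P P G′ G − (P̂₂ − P)∘G` (§73 `entry1_split`);
  MEAN VALUE along `ν` over `r` fine steps (part 57): `r·D′∘F₂ = n′·ρ′(s^r − 1)∘F₂ − Σ_{j<r} ρ′(s^j − 1)∘D′∘F₂`, and, writing `j = L^m·q + i`,
  `ρ′(s^j − 1)∘D′∘F₂ = ρ′(s^j − 1)∘D′∘G′∘P − [ρ′(s^{L^mq})∘X∘(ρ′(s^i)∘P − P)∘D∘G + X∘P∘ρ(s^q − 1)∘D∘G]` (§73 `shiftSub_X_pull_split`).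
  Majorants (all `× e^{−δd}`): `F₂ ≤ A₀ + A₁`; `ρ′(s^j−1)∘D′∘G′ ≤ H(j∕n′)^α`, `ρ(s^q−1)∘D∘G ≤ H(q∕n)^α` ((1.111), part 56); `(ρ′(s^i)∘P − P)∘D∘G ≤ A₂` (`η∇∇G`, parts 44 §33 + 57);
  `(X∘P − P)∘D∘G ≤ A₃` (part 57).  Hence ★★ `hasMaj_entry1_core` (§74): `T1 ≤ 2e^{δ}(A₀+A₁)·(n′∕r) + H(1 + e^{(2d+1)δ})·(r∕n′)^α + e^{(2d+2)δ}A₂ + A₃` for every `1 ≤ r`,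
  `4r ≤ n′`.  The sequel (part 59) takes `A₀ = C(L^k)^{−1∕4}` (part 52), `A₁ = C(L^k)⁻¹` (part 44), `A₂ = A₃ = C(L^k)^{−1∕2}`, `α = ½`, `r = L^m·L^{k−⌊k∕8⌋}` ⇒ `C·(L^k)^{−1∕16}`.
CONTENTS.  §72 `hasMaj_comp_pull_kingPrV` (King's prolongation on the SOURCE side keeps block majorants); §73 `cast_fine_eq`, `sD_sSm_pull_eq`, `entry1_split`, `pow_add_sub_one_mul`,
`shiftSub_X_pull_split`; §74 `four_mul_div_le`, ★★ `hasMaj_entry1_core`.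
HONEST FRAMING ∕ LIMITS.  Finite lattice algebra + block-majorant bookkeeping; the analytic inputs enter as HYPOTHESES here (discharged in part 59 from parts 44∕52∕56∕57, all tree theorems);
`U ≡ 1`; ENTRY 2 `𝔇(G∇*)` NOT here (no sup-only route; located: L²-block currency + (1.114)); count-neutral (typed 28∕28 · discharged 5∕27 of record unchanged); NOT a discharge of N15
(object-bound; NE2⁺ NOT PRINTED); one finite T⁴ at fixed ε — NOT infinite volume, NOT OS on ℝ⁴, NOT a mass gap, NOT Clay.
-/

noncomputable section

open scoped BigOperators
open Finset

namespace Summit.QuantumFields.YangMills.BalabanUVNodes.N15.TwoGrid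

open Literature.MathematicalPhysics.QuantumFieldTheory.Balaban1983to89
open Literature.MathematicalPhysics.QuantumFieldTheory.Balaban1983to89.B11SectG (BlockNorm HasMaj hasMaj_zero)
open Literature.MathematicalPhysics.QuantumFieldTheory.Balaban1983to89.B11AxialTransport190 (abs_le_loc_ofBlocks loc_ofBlocks_le)
open Literature.MathematicalPhysics.QuantumFieldTheory.Balaban1983to89.T4EtaRateDefect (idef idef_apply)
open Literature.MathematicalPhysics.QuantumFieldTheory.Balaban1983to89.T4EtaRateCoeffDefect (pull pull_apply)
open Literature.MathematicalPhysics.QuantumFieldTheory.Balaban1983to89.B5Prop11Plancherel (Tor fine unitVec)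
open Literature.MathematicalPhysics.QuantumFieldTheory.Balaban1983to89.B5SiteBridgeP12 (MP)
open Literature.MathematicalPhysics.QuantumFieldTheory.King1986.Torus (blockOf tdistT tdistT_nonneg)
open Literature.MathematicalPhysics.QuantumFieldTheory.Balaban1983to89.B6UnitTorusCarrier (unitTorusGeo)
open Summit.QuantumFields.YangMills.BalabanUVNodes.N15.VectorPiece (blkFine blkFine_apply kingPr kingPrV kingPrV_eq blkFine_comp_kingPrV)

variable {d : ℕ}

/-! ## §72 King's prolongation on the SOURCE side keeps block majorants -/

section SourcePull

variable {L : ℕ} [NeZero L] (M : Fin (d + 1) → ℕ) [∀ μ, NeZero (M μ)] (k m : ℕ) {F₂ : Type} [AddCommGroup F₂] [Module ℝ F₂]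

/-- **`T∘P` KEEPS THE MAJORANT OF `T`**: King's prolongation `P = pull kingPrV` maps a coarse 1-form localised in the unit block `y′` (King blocks `blkFine`) to a fine 1-form localised in the
SAME unit block (fine blocks `blockOf_{L^m·L^k}`, `blkFine ∘ kingPrV = blockOf′`) without increasing the block sup norm; hence `HasMaj (fine source) b₂ T K ⇒ HasMaj (coarse source) b₂ (T∘P) K`
(`K ≥ 0`). [cite: King1986, p.664 (pairing convention «x′ ∈ B^n(x)»)] -/
theorem hasMaj_comp_pull_kingPrV {b₂ : BlockNorm (unitTorusGeo L k M) F₂} {T : (Tor (fine (L ^ m * L ^ k) M) × Fin (d + 1) → ℝ) →ₗ[ℝ] F₂} {K : Tor M → Tor M → ℝ}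
    (hK : ∀ y y', 0 ≤ K y y')
    (h : HasMaj (BlockNorm.ofBlocks (unitTorusGeo L k M) (fun i : Tor (fine (L ^ m * L ^ k) M) × Fin (d + 1) => blockOf (L ^ m * L ^ k) M i.1)) b₂ T K) :
    HasMaj (BlockNorm.ofBlocks (unitTorusGeo L k M) (blkFine L k M)) b₂ (T ∘ₗ pull (kingPrV L k m M)) K := by
  intro y' μ hμ y
  have hblk : ∀ x' : Tor (fine (L ^ m * L ^ k) M) × Fin (d + 1), blkFine L k M (kingPrV L k m M x') = blockOf (L ^ m * L ^ k) M x'.1 := fun x' =>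
    congrFun (blkFine_comp_kingPrV M L k m) x'
  -- the prolonged source is localised in the same block …
  have hloc' : (BlockNorm.ofBlocks (unitTorusGeo L k M) (fun i : Tor (fine (L ^ m * L ^ k) M) × Fin (d + 1) => blockOf (L ^ m * L ^ k) M i.1)).IsLoc y'
      (pull (kingPrV L k m M) μ) := by
    intro x' hx'
    rw [pull_apply]
    exact hμ _ (by rw [hblk]; exact hx')
  -- … with no larger block sup norm
  have hnorm : (BlockNorm.ofBlocks (unitTorusGeo L k M) (fun i : Tor (fine (L ^ m * L ^ k) M) × Fin (d + 1) => blockOf (L ^ m * L ^ k) M i.1)).loc y' (pull (kingPrV L k m M) μ)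
      ≤ (BlockNorm.ofBlocks (unitTorusGeo L k M) (blkFine L k M)).loc y' μ := by
    refine loc_ofBlocks_le (g := unitTorusGeo L k M) (fun i : Tor (fine (L ^ m * L ^ k) M) × Fin (d + 1) => blockOf (L ^ m * L ^ k) M i.1) _
      ((BlockNorm.ofBlocks (unitTorusGeo L k M) (blkFine L k M)).loc_nonneg y' μ) fun x' hx' => ?_
    rw [pull_apply]
    exact abs_le_loc_ofBlocks (g := unitTorusGeo L k M) (blkFine L k M) μ (by rw [hblk]; exact hx')
  rw [LinearMap.comp_apply]
  exact (h y' _ hloc' y).trans (mul_le_mul_of_nonneg_left hnorm (hK y y'))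

end SourcePull

/-! ## §73 The two operator identities of the interpolation -/

/-- cast bookkeeping: `n′ = L^m·L^k = L^k·L^m` as reals. [folklore] -/
theorem cast_fine_eq (L k m : ℕ) : ((L ^ m * L ^ k : ℕ) : ℝ) = ((L ^ k : ℕ) : ℝ) * (L : ℝ) ^ m := by push_cast; ring

section Identities

variable {L : ℕ} [NeZero L] (M : Fin (d + 1) → ℕ) [∀ μ, NeZero (M μ)] (k m : ℕ) (a : ℝ)

/-- **`D′_ν∘P̂₂ = X_ν∘P∘D_ν`** with the lattice factors of record (`D′ = ρ′(n′(s_ν−1))`, `D = ρ(n(s_ν−1))`, `X_ν = ρ′(a_νΠ_{μ≠ν}a_μ²)`): part 34's `symbOp_sD_sSm_comp_pull` at `c = n`. [folklore] -/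
theorem sD_sSm_pull_eq (ν : Fin (d + 1)) :
    symbOp M (L ^ m * L ^ k) (sD M (L ^ m * L ^ k) ν ((L ^ m * L ^ k : ℕ) : ℝ)) ∘ₗ
        (symbOp M (L ^ m * L ^ k) (sSm M (L ^ m * L ^ k) (L ^ m)) ∘ₗ pull (kingPrV L k m M)) =
      symbOp M (L ^ m * L ^ k) (sA M (L ^ m * L ^ k) ν (L ^ m) * ∏ μ ∈ univ.erase ν, sA M (L ^ m * L ^ k) μ (L ^ m) ^ 2) ∘ₗ
        (pull (kingPrV L k m M) ∘ₗ symbOp M (L ^ k) (sD M (L ^ k) ν ((L ^ k : ℕ) : ℝ))) := by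
  rw [cast_fine_eq L k m]
  exact symbOp_sD_sSm_comp_pull M L k m ν ((L ^ k : ℕ) : ℝ)

/-- **THE SPLIT OF ENTRY 1**: `idef P P (D′∘G′) (D∘G) = D′∘(idef P P G′ G − (P̂₂ − P)∘G) + (X∘P − P)∘(D∘G)`. [folklore] -/
theorem entry1_split (ν : Fin (d + 1)) :
    idef (pull (kingPrV L k m M)) (pull (kingPrV L k m M))
        (symbOp M (L ^ m * L ^ k) (sD M (L ^ m * L ^ k) ν ((L ^ m * L ^ k : ℕ) : ℝ)) ∘ₗ gOp M (L ^ m * L ^ k) a)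
        (symbOp M (L ^ k) (sD M (L ^ k) ν ((L ^ k : ℕ) : ℝ)) ∘ₗ gOp M (L ^ k) a)
      = symbOp M (L ^ m * L ^ k) (sD M (L ^ m * L ^ k) ν ((L ^ m * L ^ k : ℕ) : ℝ)) ∘ₗ
          (idef (pull (kingPrV L k m M)) (pull (kingPrV L k m M)) (gOp M (L ^ m * L ^ k) a) (gOp M (L ^ k) a)
            - (symbOp M (L ^ m * L ^ k) (sSm M (L ^ m * L ^ k) (L ^ m)) ∘ₗ pull (kingPrV L k m M) - pull (kingPrV L k m M)) ∘ₗ gOp M (L ^ k) a)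
        + (symbOp M (L ^ m * L ^ k) (sA M (L ^ m * L ^ k) ν (L ^ m) * ∏ μ ∈ univ.erase ν, sA M (L ^ m * L ^ k) μ (L ^ m) ^ 2) ∘ₗ pull (kingPrV L k m M)
            - pull (kingPrV L k m M)) ∘ₗ (symbOp M (L ^ k) (sD M (L ^ k) ν ((L ^ k : ℕ) : ℝ)) ∘ₗ gOp M (L ^ k) a) := by
  have hI := sD_sSm_pull_eq (L := L) M k m ν
  -- the one non-trivial rewriting: `D′∘P̂₂∘G = X∘P∘D∘G`, fully right-associated
  have hI' : symbOp M (L ^ m * L ^ k) (sD M (L ^ m * L ^ k) ν ((L ^ m * L ^ k : ℕ) : ℝ)) ∘ₗ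
      (symbOp M (L ^ m * L ^ k) (sSm M (L ^ m * L ^ k) (L ^ m)) ∘ₗ (pull (kingPrV L k m M) ∘ₗ gOp M (L ^ k) a))
      = symbOp M (L ^ m * L ^ k) (sA M (L ^ m * L ^ k) ν (L ^ m) * ∏ μ ∈ univ.erase ν, sA M (L ^ m * L ^ k) μ (L ^ m) ^ 2) ∘ₗ
          (pull (kingPrV L k m M) ∘ₗ (symbOp M (L ^ k) (sD M (L ^ k) ν ((L ^ k : ℕ) : ℝ)) ∘ₗ gOp M (L ^ k) a)) := by
    calc symbOp M (L ^ m * L ^ k) (sD M (L ^ m * L ^ k) ν ((L ^ m * L ^ k : ℕ) : ℝ)) ∘ₗ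
          (symbOp M (L ^ m * L ^ k) (sSm M (L ^ m * L ^ k) (L ^ m)) ∘ₗ (pull (kingPrV L k m M) ∘ₗ gOp M (L ^ k) a))
        = (symbOp M (L ^ m * L ^ k) (sD M (L ^ m * L ^ k) ν ((L ^ m * L ^ k : ℕ) : ℝ)) ∘ₗ
            (symbOp M (L ^ m * L ^ k) (sSm M (L ^ m * L ^ k) (L ^ m)) ∘ₗ pull (kingPrV L k m M))) ∘ₗ gOp M (L ^ k) a := by
          simp only [LinearMap.comp_assoc]
      _ = (symbOp M (L ^ m * L ^ k) (sA M (L ^ m * L ^ k) ν (L ^ m) * ∏ μ ∈ univ.erase ν, sA M (L ^ m * L ^ k) μ (L ^ m) ^ 2) ∘ₗ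
            (pull (kingPrV L k m M) ∘ₗ symbOp M (L ^ k) (sD M (L ^ k) ν ((L ^ k : ℕ) : ℝ)))) ∘ₗ gOp M (L ^ k) a := by rw [hI]
      _ = _ := by simp only [LinearMap.comp_assoc]
  simp only [idef, LinearMap.comp_sub, LinearMap.sub_comp, LinearMap.comp_assoc]
  rw [hI']
  abel

omit [NeZero L] [∀ μ, NeZero (M μ)] in
/-- symbol identity behind the split of a `j`-step shift, `j = Rq + i`: `(s^{Rq+i} − 1)·X = s^{Rq}·X·(s^i − 1) + X·(s^{Rq} − 1)`. [folklore] -/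
theorem pow_add_sub_one_mul (ν : Fin (d + 1)) (R q i : ℕ) (X : AddMonoidAlgebra ℝ (Tor (fine (L ^ m * L ^ k) M))) :
    (sT M (L ^ m * L ^ k) ν ^ (R * q + i) - 1) * X = sT M (L ^ m * L ^ k) ν ^ (R * q) * X * (sT M (L ^ m * L ^ k) ν ^ i - 1) + X * (sT M (L ^ m * L ^ k) ν ^ (R * q) - 1) := by
  ring

/-- **THE SPLIT OF A SHIFTED SMOOTHED PROLONGATION**, `j = L^m·q + i`: `ρ′(s^j − 1)∘X∘P∘W = ρ′(s^{L^mq})∘X∘(ρ′(s^i)∘P − P)∘W + X∘P∘ρ(s^q − 1)∘W` (commutativity of the symbols, part 57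
§69 for the coarse steps). [folklore] -/
theorem shiftSub_X_pull_split (ν : Fin (d + 1)) (q i : ℕ) (X : AddMonoidAlgebra ℝ (Tor (fine (L ^ m * L ^ k) M)))
    {F₁ : Type} [AddCommGroup F₁] [Module ℝ F₁] (W : F₁ →ₗ[ℝ] (Tor (fine (L ^ k) M) × Fin (d + 1) → ℝ)) :
    symbOp M (L ^ m * L ^ k) (sT M (L ^ m * L ^ k) ν ^ (L ^ m * q + i) - 1) ∘ₗ (symbOp M (L ^ m * L ^ k) X ∘ₗ (pull (kingPrV L k m M) ∘ₗ W))
      = symbOp M (L ^ m * L ^ k) (sT M (L ^ m * L ^ k) ν ^ (L ^ m * q)) ∘ₗ (symbOp M (L ^ m * L ^ k) X ∘ₗ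
          ((symbOp M (L ^ m * L ^ k) (sT M (L ^ m * L ^ k) ν ^ i) ∘ₗ pull (kingPrV L k m M) - pull (kingPrV L k m M)) ∘ₗ W))
        + symbOp M (L ^ m * L ^ k) X ∘ₗ (pull (kingPrV L k m M) ∘ₗ (symbOp M (L ^ k) (sT M (L ^ k) ν ^ q - 1) ∘ₗ W)) := by
  -- the `End`-level identity `ρ(s^j − 1)·ρX = ρ(s^{Rq})·ρX·ρ(s^i − 1) + ρX·ρ(s^{Rq} − 1)`
  have hE : symbOp M (L ^ m * L ^ k) (sT M (L ^ m * L ^ k) ν ^ (L ^ m * q + i) - 1) * symbOp M (L ^ m * L ^ k) X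
      = symbOp M (L ^ m * L ^ k) (sT M (L ^ m * L ^ k) ν ^ (L ^ m * q)) * symbOp M (L ^ m * L ^ k) X * symbOp M (L ^ m * L ^ k) (sT M (L ^ m * L ^ k) ν ^ i - 1)
        + symbOp M (L ^ m * L ^ k) X * symbOp M (L ^ m * L ^ k) (sT M (L ^ m * L ^ k) ν ^ (L ^ m * q) - 1) := by
    simp only [← map_mul, ← map_add]
    exact congrArg _ (pow_add_sub_one_mul M k m ν (L ^ m) q i X)
  have hq := symbOp_sT_pow_mul_sub_one_comp_pull M L k m ν q
  have h1 : symbOp M (L ^ m * L ^ k) (sT M (L ^ m * L ^ k) ν ^ i - 1) ∘ₗ (pull (kingPrV L k m M) ∘ₗ W)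
      = (symbOp M (L ^ m * L ^ k) (sT M (L ^ m * L ^ k) ν ^ i) ∘ₗ pull (kingPrV L k m M) - pull (kingPrV L k m M)) ∘ₗ W := by
    rw [← LinearMap.comp_assoc, map_sub, map_one, LinearMap.sub_comp, Module.End.one_eq_id, LinearMap.id_comp]
  have h2 : symbOp M (L ^ m * L ^ k) (sT M (L ^ m * L ^ k) ν ^ (L ^ m * q) - 1) ∘ₗ (pull (kingPrV L k m M) ∘ₗ W)
      = pull (kingPrV L k m M) ∘ₗ (symbOp M (L ^ k) (sT M (L ^ k) ν ^ q - 1) ∘ₗ W) := by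
    rw [← LinearMap.comp_assoc, hq, LinearMap.comp_assoc]
  calc symbOp M (L ^ m * L ^ k) (sT M (L ^ m * L ^ k) ν ^ (L ^ m * q + i) - 1) ∘ₗ (symbOp M (L ^ m * L ^ k) X ∘ₗ (pull (kingPrV L k m M) ∘ₗ W))
      = (symbOp M (L ^ m * L ^ k) (sT M (L ^ m * L ^ k) ν ^ (L ^ m * q + i) - 1) * symbOp M (L ^ m * L ^ k) X) ∘ₗ (pull (kingPrV L k m M) ∘ₗ W) := by
        rw [Module.End.mul_eq_comp, LinearMap.comp_assoc]
    _ = (symbOp M (L ^ m * L ^ k) (sT M (L ^ m * L ^ k) ν ^ (L ^ m * q)) * symbOp M (L ^ m * L ^ k) X * symbOp M (L ^ m * L ^ k) (sT M (L ^ m * L ^ k) ν ^ i - 1))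
          ∘ₗ (pull (kingPrV L k m M) ∘ₗ W)
        + (symbOp M (L ^ m * L ^ k) X * symbOp M (L ^ m * L ^ k) (sT M (L ^ m * L ^ k) ν ^ (L ^ m * q) - 1)) ∘ₗ (pull (kingPrV L k m M) ∘ₗ W) := by
        rw [hE, LinearMap.add_comp]
    _ = _ := by
        simp only [Module.End.mul_eq_comp, LinearMap.comp_assoc]
        rw [h1, h2]

end Identities

/-! ## §74 ★★ The core estimate of entry 1 (one torus, explicit constants, free interpolation length `r`) -/

section Core

variable {L : ℕ} [NeZero L] (M : Fin (d + 1) → ℕ) [∀ μ, NeZero (M μ)] (k m : ℕ) (a : ℝ)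

/-- small Nat lemma: `4·(j ∕ R) ≤ n` from `4j ≤ R·n` (`R ≠ 0`). [folklore] -/
theorem four_mul_div_le {j R n : ℕ} (hR : R ≠ 0) (h : 4 * j ≤ R * n) : 4 * (j / R) ≤ n := by
  calc 4 * (j / R) ≤ 4 * j / R := Nat.mul_div_le_mul_div_assoc 4 j R
    _ ≤ R * n / R := Nat.div_le_div_right h
    _ = n := Nat.mul_div_cancel_left n (Nat.pos_of_ne_zero hR)

/-- ★★ **THE CORE ESTIMATE OF ENTRY 1** (one torus `M`, coarse scale `k ≥ 1`, refinement `m`, direction `ν`, explicit constants): given block majorants at a common decay rate `δ ≥ 0` for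
(F) the two-grid defect `idef P P G′ G` (`A₀`), (Sw) the output swap `(P̂₂ − P)G` (`A₁`), (Hf)∕(Hc) the `j`-step oscillations of `∇′_νG′` and `∇_νG` (`H·(j∕n′)^α`, `H·(q∕n)^α`, `4j ≤ n′`,
`4q ≤ n`), (GS) `η∇_ν∇_νG` (`A₂`) and (X) the gradient-output swap `(X_ν∘P − P)∘∇_νG` (`A₃`), then for every interpolation length `1 ≤ r ≤ n′∕4` the entry-1 operator
`idef P P (∇′_ν∘G′) (∇_ν∘G)` has the block majorant `[2e^{δ}(A₀+A₁)·(n′∕r) + H(1 + e^{(2d+1)δ})·(r∕n′)^α + e^{(2d+2)δ}A₂ + A₃]·e^{−δ|y−y′|_T}`.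
[cite: Balaban1985BackgroundPropagators, Thm 3.1 (3.42) p.397 (the entry); King1986, Prop. 3.9 (3.73) p.665 (η-rate shape)] -/
theorem hasMaj_entry1_core (ν : Fin (d + 1)) {δ A₀ A₁ A₂ A₃ H α : ℝ} (hδ : 0 ≤ δ) (hA₀ : 0 ≤ A₀) (hA₁ : 0 ≤ A₁) (hA₂ : 0 ≤ A₂)
    (hH : 0 ≤ H) (hα : 0 ≤ α) {r : ℕ} (hr1 : 1 ≤ r) (hr4 : 4 * r ≤ L ^ m * L ^ k)
    (hF : HasMaj (BlockNorm.ofBlocks (unitTorusGeo L k M) (blkFine L k M))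
      (BlockNorm.ofBlocks (unitTorusGeo L k M) (fun i : Tor (fine (L ^ m * L ^ k) M) × Fin (d + 1) => blockOf (L ^ m * L ^ k) M i.1))
      (idef (pull (kingPrV L k m M)) (pull (kingPrV L k m M)) (gOp M (L ^ m * L ^ k) a) (gOp M (L ^ k) a))
      (fun y y' => A₀ * Real.exp (-(δ * tdistT M y y'))))
    (hSw : HasMaj (BlockNorm.ofBlocks (unitTorusGeo L k M) (blkFine L k M))
      (BlockNorm.ofBlocks (unitTorusGeo L k M) (fun i : Tor (fine (L ^ m * L ^ k) M) × Fin (d + 1) => blockOf (L ^ m * L ^ k) M i.1))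
      ((symbOp M (L ^ m * L ^ k) (sSm M (L ^ m * L ^ k) (L ^ m)) ∘ₗ pull (kingPrV L k m M) - pull (kingPrV L k m M)) ∘ₗ gOp M (L ^ k) a)
      (fun y y' => A₁ * Real.exp (-(δ * tdistT M y y'))))
    (hHf : ∀ j : ℕ, 4 * j ≤ L ^ m * L ^ k →
      HasMaj (BlockNorm.ofBlocks (unitTorusGeo L k M) (fun i : Tor (fine (L ^ m * L ^ k) M) × Fin (d + 1) => blockOf (L ^ m * L ^ k) M i.1))
        (BlockNorm.ofBlocks (unitTorusGeo L k M) (fun i : Tor (fine (L ^ m * L ^ k) M) × Fin (d + 1) => blockOf (L ^ m * L ^ k) M i.1))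
        (symbOp M (L ^ m * L ^ k) (sT M (L ^ m * L ^ k) ν ^ j - 1) ∘ₗ symbOp M (L ^ m * L ^ k) (sD M (L ^ m * L ^ k) ν ((L ^ m * L ^ k : ℕ) : ℝ)) ∘ₗ
          gOp M (L ^ m * L ^ k) a)
        (fun y y' => H * ((j : ℝ) / ((L ^ m * L ^ k : ℕ) : ℝ)) ^ α * Real.exp (-(δ * tdistT M y y'))))
    (hHc : ∀ q : ℕ, 4 * q ≤ L ^ k →
      HasMaj (BlockNorm.ofBlocks (unitTorusGeo L k M) (blkFine L k M)) (BlockNorm.ofBlocks (unitTorusGeo L k M) (blkFine L k M))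
        (symbOp M (L ^ k) (sT M (L ^ k) ν ^ q - 1) ∘ₗ symbOp M (L ^ k) (sD M (L ^ k) ν ((L ^ k : ℕ) : ℝ)) ∘ₗ gOp M (L ^ k) a)
        (fun y y' => H * ((q : ℝ) / ((L ^ k : ℕ) : ℝ)) ^ α * Real.exp (-(δ * tdistT M y y'))))
    (hGS : HasMaj (BlockNorm.ofBlocks (unitTorusGeo L k M) (blkFine L k M)) (BlockNorm.ofBlocks (unitTorusGeo L k M) (blkFine L k M))
      ((((L ^ k : ℕ) : ℝ)⁻¹ • symbOp M (L ^ k) (sD M (L ^ k) ν ((L ^ k : ℕ) : ℝ))) ∘ₗ (symbOp M (L ^ k) (sD M (L ^ k) ν ((L ^ k : ℕ) : ℝ)) ∘ₗ gOp M (L ^ k) a))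
      (fun y y' => A₂ * Real.exp (-(δ * tdistT M y y'))))
    (hX : HasMaj (BlockNorm.ofBlocks (unitTorusGeo L k M) (blkFine L k M))
      (BlockNorm.ofBlocks (unitTorusGeo L k M) (fun i : Tor (fine (L ^ m * L ^ k) M) × Fin (d + 1) => blockOf (L ^ m * L ^ k) M i.1))
      ((symbOp M (L ^ m * L ^ k) (sA M (L ^ m * L ^ k) ν (L ^ m) * ∏ μ ∈ univ.erase ν, sA M (L ^ m * L ^ k) μ (L ^ m) ^ 2) ∘ₗ pull (kingPrV L k m M)
          - pull (kingPrV L k m M)) ∘ₗ (symbOp M (L ^ k) (sD M (L ^ k) ν ((L ^ k : ℕ) : ℝ)) ∘ₗ gOp M (L ^ k) a))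
      (fun y y' => A₃ * Real.exp (-(δ * tdistT M y y')))) :
    HasMaj (BlockNorm.ofBlocks (unitTorusGeo L k M) (blkFine L k M))
      (BlockNorm.ofBlocks (unitTorusGeo L k M) (fun i : Tor (fine (L ^ m * L ^ k) M) × Fin (d + 1) => blockOf (L ^ m * L ^ k) M i.1))
      (idef (pull (kingPrV L k m M)) (pull (kingPrV L k m M))
        (symbOp M (L ^ m * L ^ k) (sD M (L ^ m * L ^ k) ν ((L ^ m * L ^ k : ℕ) : ℝ)) ∘ₗ gOp M (L ^ m * L ^ k) a)
        (symbOp M (L ^ k) (sD M (L ^ k) ν ((L ^ k : ℕ) : ℝ)) ∘ₗ gOp M (L ^ k) a))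
      (fun y y' => (2 * Real.exp δ * (A₀ + A₁) * (((L ^ m * L ^ k : ℕ) : ℝ) / r) + H * (1 + Real.exp δ ^ (2 * d + 1)) * ((r : ℝ) / ((L ^ m * L ^ k : ℕ) : ℝ)) ^ α
        + Real.exp δ ^ (2 * d + 2) * A₂ + A₃) * Real.exp (-(δ * tdistT M y y'))) := by
  classical
  -- names and numerics
  have hL0 : 0 < L := Nat.pos_of_ne_zero (NeZero.ne L)
  have hR0 : L ^ m ≠ 0 := pow_ne_zero m (NeZero.ne L)
  have hn1 : 1 ≤ L ^ k := Nat.one_le_pow _ _ hL0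
  have hn'1 : 1 ≤ L ^ m * L ^ k := Nat.one_le_iff_ne_zero.mpr (Nat.mul_ne_zero hR0 (by positivity))
  have hRn' : L ^ m ≤ L ^ m * L ^ k := Nat.le_mul_of_pos_right _ hn1
  have hr_le : r ≤ L ^ m * L ^ k := by omega
  have hn0 : (0 : ℝ) < ((L ^ k : ℕ) : ℝ) := by exact_mod_cast hn1
  have hn'0 : (0 : ℝ) < ((L ^ m * L ^ k : ℕ) : ℝ) := by exact_mod_cast hn'1
  have hr0 : (0 : ℝ) < (r : ℝ) := by exact_mod_cast hr1
  have he1 : 1 ≤ Real.exp δ := Real.one_le_exp hδ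
  have hE : ∀ y y' : Tor M, 0 ≤ Real.exp (-(δ * tdistT M y y')) := fun _ _ => Real.exp_nonneg _
  set ℓ : ℝ := (r : ℝ) / ((L ^ m * L ^ k : ℕ) : ℝ) with hℓ
  have hℓ0 : 0 ≤ ℓ := div_nonneg hr0.le hn'0.le
  -- abbreviations for the block norms and the operators
  set bC := BlockNorm.ofBlocks (unitTorusGeo L k M) (blkFine L k M) with hbC
  set bF := BlockNorm.ofBlocks (unitTorusGeo L k M) (fun i : Tor (fine (L ^ m * L ^ k) M) × Fin (d + 1) => blockOf (L ^ m * L ^ k) M i.1) with hbF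
  set P := pull (kingPrV L k m M) with hP
  set G := gOp M (L ^ k) a with hG
  set G' := gOp M (L ^ m * L ^ k) a with hG'
  set D := symbOp M (L ^ k) (sD M (L ^ k) ν ((L ^ k : ℕ) : ℝ)) with hD
  set D' := symbOp M (L ^ m * L ^ k) (sD M (L ^ m * L ^ k) ν ((L ^ m * L ^ k : ℕ) : ℝ)) with hD'
  set Sm := symbOp M (L ^ m * L ^ k) (sSm M (L ^ m * L ^ k) (L ^ m)) with hSm
  set Xs : AddMonoidAlgebra ℝ (Tor (fine (L ^ m * L ^ k) M)) := sA M (L ^ m * L ^ k) ν (L ^ m) * ∏ μ ∈ univ.erase ν, sA M (L ^ m * L ^ k) μ (L ^ m) ^ 2 with hXs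
  set F₂ := idef P P G' G - (Sm ∘ₗ P - P) ∘ₗ G with hF₂
  -- (0) the split
  rw [entry1_split M k m a ν]
  -- (1) `F₂` has majorant `(A₀ + A₁)e`
  have hF2 : HasMaj bC bF F₂ (fun y y' => (A₀ + A₁) * Real.exp (-(δ * tdistT M y y'))) :=
    (hF.sub hSw).mono fun y y' => le_of_eq (by ring)
  have hA01 : 0 ≤ A₀ + A₁ := add_nonneg hA₀ hA₁
  -- (2) `ρ′(s^r − 1)∘F₂` has majorant `2e^δ(A₀+A₁)e`
  have hr_op : HasMaj bC bF (symbOp M (L ^ m * L ^ k) (sT M (L ^ m * L ^ k) ν ^ r - 1) ∘ₗ F₂) (fun y y' => 2 * Real.exp δ * (A₀ + A₁) * Real.exp (-(δ * tdistT M y y'))) := by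
    rw [map_sub, map_one, LinearMap.sub_comp, Module.End.one_eq_id, LinearMap.id_comp]
    refine ((hasMaj_sT_pow_comp M k (L ^ m * L ^ k) hA01 hδ ν hr_le hF2).sub hF2).mono fun y y' => ?_
    have h1 : (A₀ + A₁) * Real.exp (-(δ * tdistT M y y')) ≤ (A₀ + A₁) * Real.exp δ * Real.exp (-(δ * tdistT M y y')) :=
      mul_le_mul_of_nonneg_right (le_mul_of_one_le_right hA01 he1) (hE y y')
    linarith
  -- (3) the `j`-th oscillation term, `j < r`
  have hD'F2 : D' ∘ₗ F₂ = (D' ∘ₗ G') ∘ₗ P - symbOp M (L ^ m * L ^ k) Xs ∘ₗ (P ∘ₗ (D ∘ₗ G)) := by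
    have hI := sD_sSm_pull_eq (L := L) M k m ν
    have hI' : D' ∘ₗ (Sm ∘ₗ (P ∘ₗ G)) = symbOp M (L ^ m * L ^ k) Xs ∘ₗ (P ∘ₗ (D ∘ₗ G)) := by
      calc D' ∘ₗ (Sm ∘ₗ (P ∘ₗ G)) = (D' ∘ₗ (Sm ∘ₗ P)) ∘ₗ G := by simp only [LinearMap.comp_assoc]
        _ = (symbOp M (L ^ m * L ^ k) Xs ∘ₗ (P ∘ₗ D)) ∘ₗ G := by rw [hI]
        _ = _ := by simp only [LinearMap.comp_assoc]
    simp only [hF₂, idef, LinearMap.comp_sub, LinearMap.sub_comp, LinearMap.comp_assoc]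
    rw [hI']
    abel
  have hKj0 : ∀ y y' : Tor M, 0 ≤ (H * (1 + Real.exp δ ^ (2 * d + 1)) * ℓ ^ α + Real.exp δ ^ (2 * d + 2) * A₂) * Real.exp (-(δ * tdistT M y y')) := fun y y' =>
    mul_nonneg (add_nonneg (mul_nonneg (mul_nonneg hH (by positivity)) (Real.rpow_nonneg hℓ0 _)) (mul_nonneg (by positivity) hA₂)) (hE y y')
  have hterm : ∀ j ∈ range r, HasMaj bC bF (symbOp M (L ^ m * L ^ k) (sT M (L ^ m * L ^ k) ν ^ j - 1) ∘ₗ (D' ∘ₗ F₂))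
      (fun y y' => (H * (1 + Real.exp δ ^ (2 * d + 1)) * ℓ ^ α + Real.exp δ ^ (2 * d + 2) * A₂) * Real.exp (-(δ * tdistT M y y'))) := by
    intro j hj
    have hjr : j < r := mem_range.mp hj
    have hj4 : 4 * j ≤ L ^ m * L ^ k := by omega
    set q : ℕ := j / L ^ m with hq
    set i : ℕ := j % L ^ m with hi
    have hqi : L ^ m * q + i = j := Nat.div_add_mod j (L ^ m)
    have hiR : i ≤ L ^ m := (Nat.mod_lt j (Nat.pos_of_ne_zero hR0)).le
    have hq4 : 4 * q ≤ L ^ k := four_mul_div_le hR0 hj4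
    have hRqj : L ^ m * q ≤ j := Nat.mul_div_le j (L ^ m)
    have hRq : L ^ m * q ≤ L ^ m * L ^ k := hRqj.trans (hjr.le.trans hr_le)
    -- the split of the `j`-th term
    have hsplit := shiftSub_X_pull_split M k m ν q i Xs (D ∘ₗ G)
    rw [hqi] at hsplit
    have hjeq : symbOp M (L ^ m * L ^ k) (sT M (L ^ m * L ^ k) ν ^ j - 1) ∘ₗ (D' ∘ₗ F₂)
        = symbOp M (L ^ m * L ^ k) (sT M (L ^ m * L ^ k) ν ^ j - 1) ∘ₗ ((D' ∘ₗ G') ∘ₗ P)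
          - (symbOp M (L ^ m * L ^ k) (sT M (L ^ m * L ^ k) ν ^ (L ^ m * q)) ∘ₗ (symbOp M (L ^ m * L ^ k) Xs ∘ₗ
              ((symbOp M (L ^ m * L ^ k) (sT M (L ^ m * L ^ k) ν ^ i) ∘ₗ P - P) ∘ₗ (D ∘ₗ G)))
            + symbOp M (L ^ m * L ^ k) Xs ∘ₗ (P ∘ₗ (symbOp M (L ^ k) (sT M (L ^ k) ν ^ q - 1) ∘ₗ (D ∘ₗ G)))) := by
      rw [hD'F2, LinearMap.comp_sub, hsplit]
    rw [hjeq]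
    -- (i) the fine oscillation through the prolongation on the source side
    have h1 : HasMaj bC bF (symbOp M (L ^ m * L ^ k) (sT M (L ^ m * L ^ k) ν ^ j - 1) ∘ₗ ((D' ∘ₗ G') ∘ₗ P))
        (fun y y' => H * ℓ ^ α * Real.exp (-(δ * tdistT M y y'))) := by
      have h := hasMaj_comp_pull_kingPrV M k m (fun y y' => mul_nonneg (mul_nonneg hH (Real.rpow_nonneg (div_nonneg (Nat.cast_nonneg j) hn'0.le) _)) (hE y y'))
        (hHf j hj4)
      refine (h.congr fun μ => rfl).mono fun y y' => mul_le_mul_of_nonneg_right (mul_le_mul_of_nonneg_left ?_ hH) (hE y y')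
      exact Real.rpow_le_rpow (div_nonneg (Nat.cast_nonneg j) hn'0.le) (div_le_div_of_nonneg_right (by exact_mod_cast hjr.le) hn'0.le) hα
    -- (ii-A) the in-block part: a shifted, smoothed `(ρ′(s^i)P − P)∘∇G`, dominated by `η∇∇G`
    have hA : HasMaj bC bF (symbOp M (L ^ m * L ^ k) (sT M (L ^ m * L ^ k) ν ^ (L ^ m * q)) ∘ₗ (symbOp M (L ^ m * L ^ k) Xs ∘ₗ
        ((symbOp M (L ^ m * L ^ k) (sT M (L ^ m * L ^ k) ν ^ i) ∘ₗ P - P) ∘ₗ (D ∘ₗ G))))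
        (fun y y' => Real.exp δ ^ (2 * d + 2) * A₂ * Real.exp (-(δ * tdistT M y y'))) := by
      have hin := hasMaj_shiftPull_sub M k m (fun y y' => mul_nonneg hA₂ (hE y y')) ν hiR hGS
      have hprod := hasMaj_prod_sA_sq_comp M k (L ^ m * L ^ k) hA₂ hδ hR0 hRn' (univ.erase ν) hin
      have hA2' : 0 ≤ A₂ * Real.exp δ ^ (2 * (univ.erase ν).card) := mul_nonneg hA₂ (by positivity)
      have hsA := hasMaj_sA_comp M k (L ^ m * L ^ k) hA2' hδ ν hR0 hRn' hprod
      have hA2'' : 0 ≤ A₂ * Real.exp δ ^ (2 * (univ.erase ν).card) * Real.exp δ := mul_nonneg hA2' (Real.exp_nonneg _)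
      have hsh := hasMaj_sT_pow_comp M k (L ^ m * L ^ k) hA2'' hδ ν hRq hsA
      rw [hXs, map_mul, Module.End.mul_eq_comp, LinearMap.comp_assoc]
      refine hsh.mono fun y y' => le_of_eq ?_
      rw [card_erase_of_mem (mem_univ ν), card_univ, Fintype.card_fin, Nat.add_sub_cancel]
      ring
    -- (ii-B) the coarse oscillation `q` steps, prolonged and smoothed
    have hB : HasMaj bC bF (symbOp M (L ^ m * L ^ k) Xs ∘ₗ (P ∘ₗ (symbOp M (L ^ k) (sT M (L ^ k) ν ^ q - 1) ∘ₗ (D ∘ₗ G))))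
        (fun y y' => H * Real.exp δ ^ (2 * d + 1) * ℓ ^ α * Real.exp (-(δ * tdistT M y y'))) := by
      have hc := hHc q hq4
      have hqn0 : 0 ≤ (q : ℝ) / ((L ^ k : ℕ) : ℝ) := div_nonneg (Nat.cast_nonneg q) hn0.le
      have hK0 : ∀ y y' : Tor M, 0 ≤ H * ((q : ℝ) / ((L ^ k : ℕ) : ℝ)) ^ α * Real.exp (-(δ * tdistT M y y')) := fun y y' =>
        mul_nonneg (mul_nonneg hH (Real.rpow_nonneg hqn0 _)) (hE y y')
      have hpull := hasMaj_pull_comp₂ (g := unitTorusGeo L k M) (b₁ := bC) (blkFine L k M)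
        (fun i : Tor (fine (L ^ m * L ^ k) M) × Fin (d + 1) => blockOf (L ^ m * L ^ k) M i.1) (kingPrV L k m M) hK0
        (fun x y' => by rw [show blkFine L k M (kingPrV L k m M x) = blockOf (L ^ m * L ^ k) M x.1 from congrFun (blkFine_comp_kingPrV M L k m) x]) hc
      have hB0 : 0 ≤ H * ((q : ℝ) / ((L ^ k : ℕ) : ℝ)) ^ α := mul_nonneg hH (Real.rpow_nonneg hqn0 _)
      have hprod := hasMaj_prod_sA_sq_comp M k (L ^ m * L ^ k) hB0 hδ hR0 hRn' (univ.erase ν) hpull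
      have hB0' : 0 ≤ H * ((q : ℝ) / ((L ^ k : ℕ) : ℝ)) ^ α * Real.exp δ ^ (2 * (univ.erase ν).card) := mul_nonneg hB0 (by positivity)
      have hsA := hasMaj_sA_comp M k (L ^ m * L ^ k) hB0' hδ ν hR0 hRn' hprod
      rw [hXs, map_mul, Module.End.mul_eq_comp, LinearMap.comp_assoc]
      refine (hsA.congr fun μ => rfl).mono fun y y' => ?_
      rw [card_erase_of_mem (mem_univ ν), card_univ, Fintype.card_fin, Nat.add_sub_cancel]
      -- `(q/n)^α ≤ ℓ^α` since `L^m q ≤ j ≤ r`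
      have hqℓ : (q : ℝ) / ((L ^ k : ℕ) : ℝ) ≤ ℓ := by
        rw [hℓ, div_le_div_iff₀ hn0 hn'0]
        have h1 : (q : ℝ) * ((L ^ m * L ^ k : ℕ) : ℝ) = ((L ^ m * q : ℕ) : ℝ) * ((L ^ k : ℕ) : ℝ) := by push_cast; ring
        rw [h1]
        exact mul_le_mul_of_nonneg_right (by exact_mod_cast (show L ^ m * q ≤ r by omega)) hn0.le
      have hpow : ((q : ℝ) / ((L ^ k : ℕ) : ℝ)) ^ α ≤ ℓ ^ α := Real.rpow_le_rpow hqn0 hqℓ hα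
      have : H * ((q : ℝ) / ((L ^ k : ℕ) : ℝ)) ^ α * Real.exp δ ^ (2 * d) * Real.exp δ ≤ H * ℓ ^ α * Real.exp δ ^ (2 * d) * Real.exp δ := by
        gcongr
      calc H * ((q : ℝ) / ((L ^ k : ℕ) : ℝ)) ^ α * Real.exp δ ^ (2 * d) * Real.exp δ * Real.exp (-(δ * tdistT M y y'))
          ≤ H * ℓ ^ α * Real.exp δ ^ (2 * d) * Real.exp δ * Real.exp (-(δ * tdistT M y y')) := mul_le_mul_of_nonneg_right this (hE y y')
        _ = H * Real.exp δ ^ (2 * d + 1) * ℓ ^ α * Real.exp (-(δ * tdistT M y y')) := by ring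
    exact (h1.sub (hA.add hB)).mono fun y y' => le_of_eq (by ring)
  -- (4) the sum over `j < r`, the `r`-step quotient, and the mean-value identity
  have hsum := hasMaj_finsum (g := unitTorusGeo L k M) (b₁ := bC) (b₂ := bF) (range r)
    (fun j => symbOp M (L ^ m * L ^ k) (sT M (L ^ m * L ^ k) ν ^ j - 1) ∘ₗ (D' ∘ₗ F₂))
    (fun _ y y' => (H * (1 + Real.exp δ ^ (2 * d + 1)) * ℓ ^ α + Real.exp δ ^ (2 * d + 2) * A₂) * Real.exp (-(δ * tdistT M y y'))) hterm
  have hquot := hasMaj_smul_ofBlocks (g := unitTorusGeo L k M) (b₁ := bC) (fun i : Tor (fine (L ^ m * L ^ k) M) × Fin (d + 1) => blockOf (L ^ m * L ^ k) M i.1)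
    (fun y y' => mul_nonneg (mul_nonneg (mul_nonneg zero_le_two (Real.exp_nonneg _)) hA01) (hE y y')) (((L ^ m * L ^ k : ℕ) : ℝ)) hr_op
  have hbig := hasMaj_smul_ofBlocks (g := unitTorusGeo L k M) (b₁ := bC) (fun i : Tor (fine (L ^ m * L ^ k) M) × Fin (d + 1) => blockOf (L ^ m * L ^ k) M i.1)
    (fun y y' => add_nonneg (mul_nonneg (abs_nonneg _) (mul_nonneg (mul_nonneg (mul_nonneg zero_le_two (Real.exp_nonneg _)) hA01) (hE y y')))
      (sum_nonneg fun _ _ => hKj0 y y')) ((r : ℝ)⁻¹) (hquot.sub hsum)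
  have hMV : ∀ μ, ((r : ℝ)⁻¹ • ((((L ^ m * L ^ k : ℕ) : ℝ)) • (symbOp M (L ^ m * L ^ k) (sT M (L ^ m * L ^ k) ν ^ r - 1) ∘ₗ F₂)
      - ∑ j ∈ range r, symbOp M (L ^ m * L ^ k) (sT M (L ^ m * L ^ k) ν ^ j - 1) ∘ₗ (D' ∘ₗ F₂))) μ = (D' ∘ₗ F₂) μ := by
    intro μ
    have hmv := congrArg (fun T : Module.End ℝ (Tor (fine (L ^ m * L ^ k) M) × Fin (d + 1) → ℝ) => T (F₂ μ))
      (symbOp_sD_meanValue M (L ^ m * L ^ k) ν ((L ^ m * L ^ k : ℕ) : ℝ) r)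
    simp only [LinearMap.smul_apply, LinearMap.sub_apply, LinearMap.sum_apply, LinearMap.comp_apply] at hmv ⊢
    rw [← hmv, inv_smul_smul₀ hr0.ne']
  have hmain := hbig.congr hMV
  -- (5) assemble with the gradient-output swap
  refine (hmain.add hX).mono fun y y' => le_of_eq ?_
  rw [sum_const, card_range, nsmul_eq_mul, abs_of_nonneg (inv_nonneg.mpr hr0.le), abs_of_nonneg hn'0.le, hℓ]
  field_simp
  ring

end Core


end Summit.QuantumFields.YangMills.BalabanUVNodes.N15.TwoGrid
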